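import Mathlib
import Summits.RiemannHypothesis.RiemannHypothesis.Theorems.PfPersistenceAdmissibleClass
import Summits.RiemannHypothesis.RiemannHypothesis.Theorems.PfPersistenceF2PlantedIndex

/-!
# F2 / P2-LOW — a planted REAL PAIR is seen by the even SHAPE tier: its even bottom vector is NODAL

pub-rhpf fake seat 2, generation 3.  **Mechanism / rigidity campaign; no RH claims.**  Elementary and RH-free.

OBJECT (FAKES.md §2.7; observatory family `planted {δ: η, γ₀: 0}`).  Planting the real pair `{½ ± η}` with
multiplicity `w` adds to ζ's EVEN Galerkin block at the window `[-a,a]`, rank `N`, the positive rank-one matrix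
`σ c cᵀ`, `σ = 2w`, `c_n = ∫_{-a}^{a} ξ_n(x) e^{ηx} dx` (`realPairVec`; `ξ_n = xiEven (2a) n`).  Every even ENERGY
functional monotone under PSD additions is blind to it (carver FK-REALPAIR).  Question (carver R-CV2, cand-4 C4-I6
/ leaf G1.01(eo), lead §H.5): is the even SHAPE tier (`OneSigned`, `oneSignedAt`) blind too?

ANSWER (PROVED): no.  For ANY nonnegative form `Q` (ζ's even block at a served window — certified DATA), any
`σ ≥ 0`, `η`, and any eigenvector `u ≠ 0` of `Q + σ c cᵀ` with eigenvalue `λ`: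
`OneSigned (2a) u → σ a/(N+1) ≤ λ` (`le_eigenvalue_of_oneSigned`); so a bottom vector with `λ < σ a/(N+1)` is NODAL
(`not_oneSigned_of_eigenvalue_lt`, Datum level `realPair_not_mem_oneSignedAt`).  By rank-one interlacing
`λ₁(Q + σccᵀ) ≤ ε₂⁺(ζ)(a,N)` (tiny beyond the first windows, DATA), the planted real pair is even-nodal wherever its
odd sector is negative: NO planted real pair is an "eo-Perron fake" (FAKES §2.7 for the numbers).

PROOF.  (i) `λ|u|² = uᵀQu + σ⟨c,u⟩² ≥ σ⟨c,u⟩²` (`sigma_sq_dot_le`).  (ii) `⟨c,u⟩ = ∫ θ_u e^{ηx} = ∫ θ_u cosh(ηx)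
≥ ∫ θ_u` for `θ_u ≥ 0` (`θ_u` even; `realPairVec_dotProduct`, `integral_profile_le_dot`).  (iii) Parseval on the
window `∫ θ_u² = |u|²` (`integral_xiEven_mul_xiEven`, `integral_profile_sq`) and `θ_u² ≤ |u|²(N+1)·2/L`
(`profile_sq_le`) give `∫ θ_u ≥ |u| (a/(N+1))^{1/2}`.  The negative branch is the positive branch for `-u`.
-/

namespace Summit.RiemannHypothesis.RiemannHypothesis.Theorems.PfPersistenceF2RealPairNodal

open Matrix BigOperators Real MeasureTheory intervalIntegral Set
open Summit.RiemannHypothesis.RiemannHypothesis.Theorems.PfPersistence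
open Summit.RiemannHypothesis.RiemannHypothesis.Theorems.PfPersistenceF2PlantedIndex (vecMulVec_mulVec_eq)

section MatrixStep

variable {n : Type*} [Fintype n]

/-- Step (i): for an eigenvector `x` of `Q + σ c cᵀ` with eigenvalue `λ`, `Q` a nonnegative form:
`σ ⟨c,x⟩² ≤ λ |x|²`. [folklore] -/
theorem sigma_sq_dot_le (Q : Matrix n n ℝ) (hQ : ∀ v, 0 ≤ v ⬝ᵥ (Q *ᵥ v)) (c x : n → ℝ) {σ lam : ℝ}
    (hx : (Q + σ • vecMulVec c c) *ᵥ x = lam • x) :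
    σ * (c ⬝ᵥ x) ^ 2 ≤ lam * (x ⬝ᵥ x) := by
  have h1 : x ⬝ᵥ ((Q + σ • vecMulVec c c) *ᵥ x) = lam * (x ⬝ᵥ x) := by rw [hx, dotProduct_smul, smul_eq_mul]
  rw [add_mulVec, Matrix.smul_mulVec, vecMulVec_mulVec_eq, dotProduct_add, dotProduct_smul,
    dotProduct_smul, dotProduct_comm x c] at h1
  simp only [smul_eq_mul] at h1
  have h2 : (c ⬝ᵥ x) ^ 2 = (c ⬝ᵥ x) * (c ⬝ᵥ x) := sq _
  linarith [hQ x]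

end MatrixStep

section Basis

variable (L : ℝ) {N : ℕ}

/-- `ξ_n` is continuous. -/
theorem continuous_xiEven (n : ℕ) : Continuous (xiEven L n) := by
  by_cases hn : n = 0
  · have h : xiEven L n = fun _ => 1 / Real.sqrt L := by
      funext x; simp [xiEven, hn]
    rw [h]; exact continuous_const
  · have h : xiEven L n = fun x => (-1 : ℝ) ^ n * Real.sqrt (2 / L) * Real.cos (2 * π * n * x / L) := by
      funext x; simp [xiEven, hn]
    rw [h]; fun_prop

/-- `θ_u` is continuous. -/
theorem continuous_profile (u : Fin (N + 1) → ℝ) : Continuous (profile L u) := by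
  have h : profile L u = fun x => ∑ n : Fin (N + 1), u n * xiEven L n x := by funext x; rfl
  rw [h]
  exact continuous_finsetSum _ (fun n _ => continuous_const.mul (continuous_xiEven L n))

/-- `ξ_n` is even. -/
theorem xiEven_neg (n : ℕ) (x : ℝ) : xiEven L n (-x) = xiEven L n x := by
  unfold xiEven
  split_ifs
  · rfl
  · rw [show 2 * π * (n : ℝ) * -x / L = -(2 * π * n * x / L) by ring, Real.cos_neg]

/-- `θ_u` is even. -/
theorem profile_neg (u : Fin (N + 1) → ℝ) (x : ℝ) : profile L u (-x) = profile L u x := by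
  simp [profile, xiEven_neg]

/-- `θ_{-u} = -θ_u`. -/
theorem profile_neg_vec (u : Fin (N + 1) → ℝ) (x : ℝ) : profile L (-u) x = -profile L u x := by
  simp [profile, Finset.sum_neg_distrib, neg_mul]

/-- `ξ_n(x)² ≤ 2/L`. -/
theorem sq_xiEven_le (hL : 0 < L) (n : ℕ) (x : ℝ) : xiEven L n x ^ 2 ≤ 2 / L := by
  unfold xiEven
  split_ifs with hn
  · rw [div_pow, one_pow, Real.sq_sqrt hL.le]
    exact div_le_div_of_nonneg_right (by norm_num) hL.le
  · rw [mul_pow, mul_pow, ← pow_mul, show n * 2 = 2 * n by ring, pow_mul, neg_one_sq, one_pow, one_mul,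
      Real.sq_sqrt (by positivity)]
    calc 2 / L * Real.cos (2 * π * n * x / L) ^ 2 ≤ 2 / L * 1 := by
          gcongr
          exact Real.cos_sq_le_one _
      _ = 2 / L := mul_one _

/-- `θ_u(x)² ≤ |u|² · (N+1) · 2/L` (Cauchy–Schwarz). -/
theorem profile_sq_le (hL : 0 < L) (u : Fin (N + 1) → ℝ) (x : ℝ) :
    profile L u x ^ 2 ≤ (u ⬝ᵥ u) * ((N + 1) * (2 / L)) := by
  have hcs := Finset.sum_mul_sq_le_sq_mul_sq Finset.univ u (fun n : Fin (N + 1) => xiEven L n x)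
  have hsum : ∑ n : Fin (N + 1), xiEven L n x ^ 2 ≤ (N + 1) * (2 / L) := by
    calc ∑ n : Fin (N + 1), xiEven L n x ^ 2 ≤ ∑ _n : Fin (N + 1), (2 / L) :=
          Finset.sum_le_sum (fun n _ => sq_xiEven_le L hL n x)
      _ = (N + 1) * (2 / L) := by simp
  have huu : u ⬝ᵥ u = ∑ n, u n ^ 2 := by simp [dotProduct, sq]
  have hprof : profile L u x = ∑ n, u n * xiEven L n x := rfl
  rw [hprof, huu]
  calc (∑ n : Fin (N + 1), u n * xiEven L n x) ^ 2
        ≤ (∑ n : Fin (N + 1), u n ^ 2) * ∑ n : Fin (N + 1), xiEven L n x ^ 2 := hcs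
    _ ≤ (∑ n : Fin (N + 1), u n ^ 2) * ((N + 1) * (2 / L)) :=
        mul_le_mul_of_nonneg_left hsum (Finset.sum_nonneg (fun n _ => sq_nonneg _))

/-- `∫_{-L/2}^{L/2} cos(2π k x / L) dx = 0` for a nonzero integer `k`. -/
theorem integral_cos_periods (hL : 0 < L) (k : ℤ) (hk : k ≠ 0) :
    ∫ x in -(L / 2)..(L / 2), Real.cos (2 * π * k * x / L) = 0 := by
  have hk' : (k : ℝ) ≠ 0 := Int.cast_ne_zero.mpr hk
  have hc : (2 * π * k / L : ℝ) ≠ 0 := div_ne_zero (mul_ne_zero (by positivity) hk') hL.ne'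
  have h1 : (fun x => Real.cos (2 * π * k * x / L)) = fun x => Real.cos ((2 * π * k / L) * x) := by
    funext x; ring_nf
  rw [h1, intervalIntegral.integral_comp_mul_left (fun x => Real.cos x) hc, integral_cos]
  have h2 : 2 * π * (k : ℝ) / L * (L / 2) = (k : ℝ) * π := by field_simp
  rw [mul_neg, h2, Real.sin_neg, Real.sin_int_mul_pi]; simp

/-- the same with the frequency written as a real number that is a nonzero integer. -/
theorem integral_cos_periods' (hL : 0 < L) {r : ℝ} (k : ℤ) (hk : k ≠ 0) (hr : r = k) :
    ∫ x in -(L / 2)..(L / 2), Real.cos (2 * π * r * x / L) = 0 := by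
  subst hr; exact integral_cos_periods L hL k hk

/-- products of cosines at integer frequencies `n, m ≥ 1`: `∫ cos(2πnx/L) cos(2πmx/L) = (L/2)·[n = m]`. -/
theorem integral_cos_mul_cos (hL : 0 < L) (n m : ℕ) (hn : n ≠ 0) (hm : m ≠ 0) :
    ∫ x in -(L / 2)..(L / 2), Real.cos (2 * π * n * x / L) * Real.cos (2 * π * m * x / L)
      = if n = m then L / 2 else 0 := by
  have hprod : ∀ x, Real.cos (2 * π * n * x / L) * Real.cos (2 * π * m * x / L)
      = (Real.cos (2 * π * ((n : ℝ) + m) * x / L) + Real.cos (2 * π * ((n : ℝ) - m) * x / L)) / 2 := by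
    intro x
    have e1 : 2 * π * ((n : ℝ) + m) * x / L = 2 * π * n * x / L + 2 * π * m * x / L := by ring
    have e2 : 2 * π * ((n : ℝ) - m) * x / L = 2 * π * n * x / L - 2 * π * m * x / L := by ring
    rw [e1, e2, Real.cos_add, Real.cos_sub]; ring
  have hc1 : Continuous fun x => Real.cos (2 * π * ((n : ℝ) + m) * x / L) := by fun_prop
  have hc2 : Continuous fun x => Real.cos (2 * π * ((n : ℝ) - m) * x / L) := by fun_prop
  simp_rw [hprod]
  rw [intervalIntegral.integral_div, intervalIntegral.integral_add (hc1.intervalIntegrable _ _)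
    (hc2.intervalIntegrable _ _)]
  have hsum : ∫ x in -(L / 2)..(L / 2), Real.cos (2 * π * ((n : ℝ) + m) * x / L) = 0 :=
    integral_cos_periods' L hL ((n : ℤ) + m) (by have := hn; have := hm; omega) (by push_cast; ring)
  rw [hsum, zero_add]
  by_cases hnm : n = m
  · subst hnm
    simp only [sub_self, mul_zero, zero_mul, zero_div, Real.cos_zero, if_true]
    rw [intervalIntegral.integral_const, smul_eq_mul]; ring
  · rw [if_neg hnm]
    have hne : ((n : ℤ) - m) ≠ 0 := by omega
    rw [integral_cos_periods' L hL ((n : ℤ) - m) hne (by push_cast; ring)]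
    simp

/-- ORTHONORMALITY of Connes' even basis on the window `[-L/2, L/2]`. [folklore] -/
theorem integral_xiEven_mul_xiEven (hL : 0 < L) (n m : ℕ) :
    ∫ x in -(L / 2)..(L / 2), xiEven L n x * xiEven L m x = if n = m then 1 else 0 := by
  have hsq : Real.sqrt L * Real.sqrt L = L := Real.mul_self_sqrt hL.le
  have hsq2 : Real.sqrt (2 / L) ^ 2 = 2 / L := Real.sq_sqrt (by positivity)
  by_cases hn : n = 0 <;> by_cases hm : m = 0
  · subst hn; subst hm
    have h : (fun x => xiEven L 0 x * xiEven L 0 x) = fun _ => 1 / L := by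
      funext x; simp only [xiEven, if_true]; rw [div_mul_div_comm, one_mul, hsq]
    rw [h, intervalIntegral.integral_const, smul_eq_mul, if_pos rfl]
    field_simp; ring
  · subst hn
    rw [if_neg (Ne.symm hm)]
    have h : (fun x => xiEven L 0 x * xiEven L m x)
        = fun x => (1 / Real.sqrt L * ((-1 : ℝ) ^ m * Real.sqrt (2 / L))) * Real.cos (2 * π * m * x / L) := by
      funext x; simp only [xiEven, if_true, hm, if_false]; ring
    rw [h, intervalIntegral.integral_const_mul, integral_cos_periods' L hL (m : ℤ) (by omega) (by push_cast; ring),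
      mul_zero]
  · subst hm
    rw [if_neg hn]
    have h : (fun x => xiEven L n x * xiEven L 0 x)
        = fun x => ((-1 : ℝ) ^ n * Real.sqrt (2 / L) * (1 / Real.sqrt L)) * Real.cos (2 * π * n * x / L) := by
      funext x; simp only [xiEven, if_true, hn, if_false]; ring
    rw [h, intervalIntegral.integral_const_mul, integral_cos_periods' L hL (n : ℤ) (by omega) (by push_cast; ring),
      mul_zero]
  · have h : (fun x => xiEven L n x * xiEven L m x)
        = fun x => ((-1 : ℝ) ^ n * (-1 : ℝ) ^ m * Real.sqrt (2 / L) ^ 2)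
            * (Real.cos (2 * π * n * x / L) * Real.cos (2 * π * m * x / L)) := by
      funext x; simp only [xiEven, hn, hm, if_false]; ring
    rw [h, intervalIntegral.integral_const_mul, integral_cos_mul_cos L hL n m hn hm, hsq2]
    by_cases hnm : n = m
    · subst hnm
      rw [if_pos rfl, if_pos rfl, ← pow_add, ← two_mul, pow_mul, neg_one_sq, one_pow, one_mul]
      field_simp
    · rw [if_neg hnm, if_neg hnm, mul_zero]

/-- PARSEVAL on the window: `∫_{-L/2}^{L/2} θ_u(x)² dx = |u|²`. [folklore] -/
theorem integral_profile_sq (hL : 0 < L) (u : Fin (N + 1) → ℝ) :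
    ∫ x in -(L / 2)..(L / 2), profile L u x ^ 2 = u ⬝ᵥ u := by
  have hterm : ∀ n m : Fin (N + 1),
      IntervalIntegrable (fun x => u n * xiEven L n x * (u m * xiEven L m x)) volume (-(L / 2)) (L / 2) := by
    intro n m
    apply Continuous.intervalIntegrable
    exact (continuous_const.mul (continuous_xiEven L n)).mul (continuous_const.mul (continuous_xiEven L m))
  have hinner : ∀ n : Fin (N + 1),
      IntervalIntegrable (fun x => ∑ m : Fin (N + 1), u n * xiEven L n x * (u m * xiEven L m x))
        volume (-(L / 2)) (L / 2) := by
    intro n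
    apply Continuous.intervalIntegrable
    exact continuous_finsetSum _ (fun m _ => (continuous_const.mul (continuous_xiEven L n)).mul
      (continuous_const.mul (continuous_xiEven L m)))
  have h1 : (fun x => profile L u x ^ 2)
      = fun x => ∑ n : Fin (N + 1), ∑ m : Fin (N + 1), u n * xiEven L n x * (u m * xiEven L m x) := by
    funext x
    rw [sq, show profile L u x = ∑ n : Fin (N + 1), u n * xiEven L n x from rfl, Finset.sum_mul_sum]
  rw [h1, intervalIntegral.integral_finsetSum (fun n _ => hinner n)]
  have h2 : ∀ n : Fin (N + 1),
      ∫ x in -(L / 2)..(L / 2), ∑ m : Fin (N + 1), u n * xiEven L n x * (u m * xiEven L m x)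
        = u n * u n := by
    intro n
    rw [intervalIntegral.integral_finsetSum (fun m _ => hterm n m)]
    have h3 : ∀ m : Fin (N + 1),
        ∫ x in -(L / 2)..(L / 2), u n * xiEven L n x * (u m * xiEven L m x)
          = u n * u m * (if n = m then 1 else 0) := by
      intro m
      have h4 : (fun x => u n * xiEven L n x * (u m * xiEven L m x))
          = fun x => (u n * u m) * (xiEven L n x * xiEven L m x) := by
        funext x; ring
      rw [h4, intervalIntegral.integral_const_mul, integral_xiEven_mul_xiEven L hL]
      congr 1
      simp [Fin.val_inj]
    simp_rw [h3]
    simp [mul_ite]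
  simp_rw [h2]
  simp [dotProduct]

end Basis

section RealPair

variable (L : ℝ) {N : ℕ}

/-- the real-pair planted vector at the window of length `L = 2a`, rank `N`: `c_n = ∫ ξ_n(x) e^{ηx} dx`
(= `Re u_n(η)` of FAKES §2.0; `u_{-p}`-components live in the odd block and are not needed here). [folklore] -/
noncomputable def realPairVec (η : ℝ) (L : ℝ) (N : ℕ) : Fin (N + 1) → ℝ :=
  fun n => ∫ x in -(L / 2)..(L / 2), xiEven L n x * Real.exp (η * x)

/-- `⟨c, u⟩ = ∫ θ_u(x) e^{ηx} dx`. -/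
theorem realPairVec_dotProduct (η : ℝ) (u : Fin (N + 1) → ℝ) :
    realPairVec η L N ⬝ᵥ u = ∫ x in -(L / 2)..(L / 2), profile L u x * Real.exp (η * x) := by
  have h1 : (fun x => profile L u x * Real.exp (η * x))
      = fun x => ∑ n : Fin (N + 1), u n * (xiEven L n x * Real.exp (η * x)) := by
    funext x
    rw [show profile L u x = ∑ n : Fin (N + 1), u n * xiEven L n x from rfl, Finset.sum_mul]
    apply Finset.sum_congr rfl; intro n _; ring
  rw [h1, intervalIntegral.integral_finsetSum]
  · simp only [dotProduct, realPairVec]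
    apply Finset.sum_congr rfl
    intro n _
    rw [intervalIntegral.integral_const_mul, mul_comm]
  · intro n _
    apply Continuous.intervalIntegrable
    exact continuous_const.mul ((continuous_xiEven L n).mul (by fun_prop))

/-- Step (ii): if `θ_u ≥ 0` on the window then `∫ θ_u ≤ ⟨c, u⟩` (`θ_u` is even, `cosh ≥ 1`). -/
theorem integral_profile_le_dot (η : ℝ) (u : Fin (N + 1) → ℝ)
    (hpos : ∀ x ∈ Icc (-(L / 2)) (L / 2), 0 ≤ profile L u x) (hL : 0 < L) :
    ∫ x in -(L / 2)..(L / 2), profile L u x ≤ realPairVec η L N ⬝ᵥ u := by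
  have hab : -(L / 2) ≤ L / 2 := by linarith
  have hcp := continuous_profile L u
  have hsym : ∫ x in -(L / 2)..(L / 2), profile L u x * Real.exp (-(η * x))
      = ∫ x in -(L / 2)..(L / 2), profile L u x * Real.exp (η * x) := by
    have h := intervalIntegral.integral_comp_neg (a := -(L / 2)) (b := L / 2)
      (f := fun x => profile L u x * Real.exp (η * x))
    simp only [neg_neg] at h
    rw [← h]
    congr 1; funext x; rw [profile_neg, mul_neg]
  have hcosh : realPairVec η L N ⬝ᵥ u
      = ∫ x in -(L / 2)..(L / 2), profile L u x * Real.cosh (η * x) := by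
    rw [realPairVec_dotProduct]
    have h2 : (fun x => profile L u x * Real.cosh (η * x))
        = fun x => (profile L u x * Real.exp (η * x) + profile L u x * Real.exp (-(η * x))) / 2 := by
      funext x; rw [Real.cosh_eq]; ring
    have hi1 : IntervalIntegrable (fun x => profile L u x * Real.exp (η * x)) volume (-(L / 2)) (L / 2) := by
      apply Continuous.intervalIntegrable; exact hcp.mul (by fun_prop)
    have hi2 : IntervalIntegrable (fun x => profile L u x * Real.exp (-(η * x))) volume (-(L / 2)) (L / 2) := by
      apply Continuous.intervalIntegrable; exact hcp.mul (by fun_prop)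
    rw [h2, intervalIntegral.integral_div, intervalIntegral.integral_add hi1 hi2, hsym]
    ring
  rw [hcosh]
  have hi3 : IntervalIntegrable (fun x => profile L u x * Real.cosh (η * x)) volume (-(L / 2)) (L / 2) := by
    apply Continuous.intervalIntegrable; exact hcp.mul (by fun_prop)
  apply intervalIntegral.integral_mono_on hab (hcp.intervalIntegrable _ _) hi3
  intro x hx
  exact le_mul_of_one_le_right (hpos x hx) (Real.one_le_cosh _)

/-- MAIN INEQUALITY (positive branch). `Q` a nonnegative form, `σ ≥ 0`, `u ≠ 0` an eigenvector of `Q + σ c cᵀ`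
with eigenvalue `λ` whose profile is `≥ 0` on the window: `σ L / (2 (N+1)) ≤ λ`. -/
theorem le_eigenvalue_of_profile_nonneg (hL : 0 < L) (Q : Matrix (Fin (N + 1)) (Fin (N + 1)) ℝ)
    (hQ : ∀ v, 0 ≤ v ⬝ᵥ (Q *ᵥ v)) {σ lam : ℝ} (η : ℝ) (hσ : 0 ≤ σ) (u : Fin (N + 1) → ℝ) (hu0 : u ≠ 0)
    (hu : (Q + σ • vecMulVec (realPairVec η L N) (realPairVec η L N)) *ᵥ u = lam • u)
    (hpos : ∀ x ∈ Icc (-(L / 2)) (L / 2), 0 ≤ profile L u x) :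
    σ * L / (2 * (N + 1)) ≤ lam := by
  set c := realPairVec η L N with hc
  set K : ℝ := (N + 1) * (2 / L) with hK
  have hab : -(L / 2) ≤ L / 2 := by linarith
  have hcp := continuous_profile L u
  have hK0 : 0 < K := mul_pos (by positivity) (div_pos two_pos hL)
  have huu : 0 < u ⬝ᵥ u := by
    rcases Function.ne_iff.mp hu0 with ⟨i, hi⟩
    have hi' : u i ≠ 0 := by simpa using hi
    have hsq : 0 < u i ^ 2 := by rw [sq]; exact mul_self_pos.mpr hi'
    have : u ⬝ᵥ u = ∑ n, u n ^ 2 := by simp [dotProduct, sq]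
    rw [this]
    exact lt_of_lt_of_le hsq (Finset.single_le_sum (fun n _ => sq_nonneg (u n)) (Finset.mem_univ i))
  have hA : σ * (c ⬝ᵥ u) ^ 2 ≤ lam * (u ⬝ᵥ u) := sigma_sq_dot_le Q hQ c u hu
  set M := Real.sqrt ((u ⬝ᵥ u) * K) with hM
  have hM0 : 0 < M := Real.sqrt_pos.mpr (mul_pos huu hK0)
  have hMsq : M ^ 2 = (u ⬝ᵥ u) * K := Real.sq_sqrt (mul_pos huu hK0).le
  have hθM : ∀ x ∈ Icc (-(L / 2)) (L / 2), profile L u x ≤ M := by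
    intro x hx
    exact (Real.le_sqrt (hpos x hx) (mul_pos huu hK0).le).mpr (profile_sq_le L hL u x)
  set I := ∫ x in -(L / 2)..(L / 2), profile L u x with hI
  have hpars : ∫ x in -(L / 2)..(L / 2), profile L u x ^ 2 = u ⬝ᵥ u := integral_profile_sq L hL u
  have h1 : u ⬝ᵥ u ≤ M * I := by
    rw [← hpars, hI, ← intervalIntegral.integral_const_mul]
    have hi4 : IntervalIntegrable (fun x => profile L u x ^ 2) volume (-(L / 2)) (L / 2) := by
      apply Continuous.intervalIntegrable; exact hcp.pow 2
    have hi5 : IntervalIntegrable (fun x => M * profile L u x) volume (-(L / 2)) (L / 2) := by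
      apply Continuous.intervalIntegrable; exact continuous_const.mul hcp
    apply intervalIntegral.integral_mono_on hab hi4 hi5
    intro x hx
    rw [sq]
    exact mul_le_mul_of_nonneg_right (hθM x hx) (hpos x hx)
  have h2 : I ≤ c ⬝ᵥ u := integral_profile_le_dot L η u hpos hL
  have hI0 : 0 < I := by
    by_contra h
    linarith [mul_nonpos_of_nonneg_of_nonpos hM0.le (not_lt.mp h)]
  have hcu : 0 < c ⬝ᵥ u := lt_of_lt_of_le hI0 h2
  have h3 : (u ⬝ᵥ u) ^ 2 ≤ M ^ 2 * (c ⬝ᵥ u) ^ 2 := by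
    calc (u ⬝ᵥ u) ^ 2 ≤ (M * I) ^ 2 := by gcongr
      _ = M ^ 2 * I ^ 2 := by ring
      _ ≤ M ^ 2 * (c ⬝ᵥ u) ^ 2 := by gcongr
  rw [hMsq] at h3
  have h4 : u ⬝ᵥ u ≤ K * (c ⬝ᵥ u) ^ 2 := by
    have h5 : (u ⬝ᵥ u) * (u ⬝ᵥ u) ≤ (u ⬝ᵥ u) * (K * (c ⬝ᵥ u) ^ 2) := by nlinarith [h3]
    exact le_of_mul_le_mul_left h5 huu
  have h6 : σ * (u ⬝ᵥ u) ≤ K * (lam * (u ⬝ᵥ u)) := by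
    calc σ * (u ⬝ᵥ u) ≤ σ * (K * (c ⬝ᵥ u) ^ 2) := mul_le_mul_of_nonneg_left h4 hσ
      _ = K * (σ * (c ⬝ᵥ u) ^ 2) := by ring
      _ ≤ K * (lam * (u ⬝ᵥ u)) := mul_le_mul_of_nonneg_left hA hK0.le
  have h7 : σ ≤ K * lam := le_of_mul_le_mul_right (by linarith) huu
  have h8 : σ * L / (2 * (N + 1)) = σ / K := by rw [hK]; field_simp
  rw [h8, div_le_iff₀ hK0]; linarith

/-- MAIN THEOREM. Either sign: `OneSigned L u → σ L/(2(N+1)) ≤ λ`. [folklore] -/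
theorem le_eigenvalue_of_oneSigned (hL : 0 < L) (Q : Matrix (Fin (N + 1)) (Fin (N + 1)) ℝ)
    (hQ : ∀ v, 0 ≤ v ⬝ᵥ (Q *ᵥ v)) {σ lam : ℝ} (η : ℝ) (hσ : 0 ≤ σ) (u : Fin (N + 1) → ℝ) (hu0 : u ≠ 0)
    (hu : (Q + σ • vecMulVec (realPairVec η L N) (realPairVec η L N)) *ᵥ u = lam • u)
    (h1 : OneSigned L u) : σ * L / (2 * (N + 1)) ≤ lam := by
  rcases h1 with hpos | hneg
  · exact le_eigenvalue_of_profile_nonneg L hL Q hQ η hσ u hu0 hu hpos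
  · have hu' : (Q + σ • vecMulVec (realPairVec η L N) (realPairVec η L N)) *ᵥ (-u) = lam • (-u) := by
      rw [mulVec_neg, hu, smul_neg]
    refine le_eigenvalue_of_profile_nonneg L hL Q hQ η hσ (-u) (neg_ne_zero.mpr hu0) hu' ?_
    intro x hx
    rw [profile_neg_vec]
    linarith [hneg x hx]

/-- Contrapositive: a bottom (or any) eigenvector with eigenvalue `λ < σ L / (2 (N+1))` is NODAL. [folklore] -/
theorem not_oneSigned_of_eigenvalue_lt (hL : 0 < L) (Q : Matrix (Fin (N + 1)) (Fin (N + 1)) ℝ)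
    (hQ : ∀ v, 0 ≤ v ⬝ᵥ (Q *ᵥ v)) {σ lam : ℝ} (η : ℝ) (hσ : 0 ≤ σ) (u : Fin (N + 1) → ℝ) (hu0 : u ≠ 0)
    (hu : (Q + σ • vecMulVec (realPairVec η L N) (realPairVec η L N)) *ᵥ u = lam • u)
    (hlam : lam < σ * L / (2 * (N + 1))) : ¬ OneSigned L u :=
  fun h1 => absurd (le_eigenvalue_of_oneSigned L hL Q hQ η hσ u hu0 hu h1) (not_le.mpr hlam)

end RealPair

section DatumLevel

/-- For a datum whose block at `win` is ζ's block plus `σ c cᵀ` (`c = realPairVec η (2a) N`, `σ = 2w ≥ 0`), with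
ζ's block a nonnegative form at that window (certified DATA per served window) and bottom Rayleigh value
`< σ a / (N+1)`: the datum is NOT in the one-signed class at `win` — its even bottom vector is nodal.  With rank-one
interlacing `λ₁ ≤ ε₂⁺(ζ)(a,N)` this is every served window with `ε₂⁺(ζ)(a,N) < 2w a/(N+1)` (FAKES §2.7). [folklore] -/
theorem realPair_not_mem_oneSignedAt (win : Window) (hζ : ∀ v, 0 ≤ v ⬝ᵥ (zetaDatum win *ᵥ v))
    {σ : ℝ} (η : ℝ) (hσ : 0 ≤ σ) (d : Datum)
    (hd : d win = zetaDatum win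
      + σ • vecMulVec (realPairVec η (2 * win.a) win.N) (realPairVec η (2 * win.a) win.N))
    (hlam : bottomRayleigh (d win) < σ * win.a / (win.N + 1)) : d ∉ oneSignedAt win := by
  rintro ⟨u, ⟨hu0, hbot⟩, h1⟩
  have hL : 0 < 2 * win.a := by linarith [win.ha]
  have hu : (zetaDatum win + σ • vecMulVec (realPairVec η (2 * win.a) win.N) (realPairVec η (2 * win.a) win.N))
      *ᵥ u = bottomRayleigh (d win) • u := by rw [← hd]; exact hbot
  have h := le_eigenvalue_of_oneSigned (2 * win.a) hL (zetaDatum win) hζ η hσ u hu0 hu h1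
  have h' : σ * (2 * win.a) / (2 * (win.N + 1)) = σ * win.a / (win.N + 1) := by field_simp
  exact absurd (h'.symm ▸ h) (not_le.mpr hlam)

end DatumLevel

end Summit.RiemannHypothesis.RiemannHypothesis.Theorems.PfPersistenceF2RealPairNodal
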